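import Summits.Schanuel.Schanuel.Theorems.ZilberEacComplexPerturbedBM
import Summits.Schanuel.Schanuel.Theorems.ZilberEacComplexPunctureDecouplingLemmas
import Literature.ModelTheory.ExponentialFields.Languages
import HarnessLib

/-!
# EC over a negative graph hypersurface with Brownawell–Masser puncture fibre

A case of Zilber's Exponential-Algebraic Closedness for `ℂ_exp` in the open range
`dim π₁(V) = n - 1` (first open rung EC₃,₂: Mantova–Masser, PLMS 129 (2024), §1 p. 5; state of
the art Aslanyan–Gallinaro arXiv:2409.12860 §3.4, Dill–Gallinaro arXiv:2506.07550 §1.2):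

* `exists_good_direction` — lattice directions `q` with `Q(2πi q) ≠ 0` and `Re h(2πi q) < 0`;
* `exists_expPoint_punctureBM_avoiding`, `exists_expPoint_punctureBM` — for `g ∈ ℂ[x₁..xₛ]` with a lattice direction of negative leading
  real part, `W ⊆ ℂˢ × ℂˢ` a Brownawell–Masser variety (irreducible, `dim W = s`, dominant additive
  projection) and arbitrary `Fⱼ ∈ ℂ[u, x]`, there is `x` with
  `(x, (e^{xⱼ} - e^{g(x)} Fⱼ(e^{g(x)}, x))ⱼ) ∈ W` (and `h(x) ≠ 0` for any given `h ≠ 0`: Zariski density over the base);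
* `punctureBM_inter_expGraph_nonempty` — the `(s+1)`-fold
  `V = {xₙ = g(x'), (x', (yⱼ - yₙ Fⱼ(yₙ, x'))ⱼ) ∈ W}` meets the graph of `exp`.

The engine is the localized perturbed Brownawell–Masser theorem
`exists_localized_perturbed_of_dominant` (file `ZilberEacComplexPerturbedBM.lean`). This
generalizes `exists_expPoint_punctureDecoupling` (`ZilberEacComplexPunctureDecoupling.lean`,
the case `W = {yⱼ = aⱼ xⱼ + bⱼ}`). HONEST FRAMING: a modest new sub-rung of EAC; no bearing on
Schanuel's conjecture.
-/

noncomputable section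

open Complex MvPolynomial Metric Set Filter Topology
open Literature.NumberTheory.Transcendental

set_option linter.dupNamespace false

namespace Summit.Schanuel.Schanuel.Theorems

/-! ### Good lattice directions -/

/-- **A lattice direction avoiding a hypersurface and keeping a sign.** If `Q ≠ 0` and the form
`h` of degree `D ≥ 1` has `Re h(2πi q₀) < 0` at some lattice direction, then some lattice
direction `q` has both `Q(2πi q) ≠ 0` and `Re h(2πi q) < 0` (take `q = q₁ + m q₀` with
`Q(2πi q₁) ≠ 0` and `m` large: `Q` has finitely many zeros on the line, and
`h(2πi(q₁ + m q₀)) = m^D h(2πi(q₀ + q₁/m))`). [folklore] -/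
theorem exists_good_direction {s : ℕ} (Q : MvPolynomial (Fin s) ℂ) (hQ : Q ≠ 0)
    (h : MvPolynomial (Fin s) ℂ) {D : ℕ} (hh : h.IsHomogeneous D)
    (q₀ : Fin s → ℤ) (hq₀ : (eval (fun j => 2 * Real.pi * I * (q₀ j : ℂ)) h).re < 0) :
    ∃ q : Fin s → ℤ, eval (fun j => 2 * Real.pi * I * (q j : ℂ)) Q ≠ 0 ∧
      (eval (fun j => 2 * Real.pi * I * (q j : ℂ)) h).re < 0 := by
  classical
  obtain ⟨q₁, hq₁⟩ := Literature.NumberTheory.Transcendental.ExpDominant.exists_int_eval_ne_zero Q hQ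
  set v₀ : Fin s → ℂ := fun j => 2 * Real.pi * I * (q₀ j : ℂ) with hv₀
  set v₁ : Fin s → ℂ := fun j => 2 * Real.pi * I * (q₁ j : ℂ) with hv₁
  have hline : ∀ m : ℕ, (fun j => 2 * Real.pi * I * ((q₁ j + (m : ℤ) * q₀ j : ℤ) : ℂ)) =
      v₁ + (m : ℂ) • v₀ := by
    intro m; funext j
    simp only [hv₀, hv₁, Pi.add_apply, Pi.smul_apply, smul_eq_mul]
    push_cast
    ring
  -- (a) `Q` does not vanish at `v₁ + m v₀` for large `m`
  set Ψ : Polynomial ℂ :=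
    MvPolynomial.aeval (fun i => Polynomial.C (v₁ i) + Polynomial.X * Polynomial.C (v₀ i)) Q with hΨ
  have hΨeval : ∀ z : ℂ, Ψ.eval z = eval (v₁ + z • v₀) Q := by
    intro z
    rw [hΨ, ← Polynomial.coe_aeval_eq_eval, ← AlgHom.comp_apply, MvPolynomial.comp_aeval,
      MvPolynomial.aeval_eq_eval]
    have hF : (fun i => (Polynomial.aeval z) (Polynomial.C (v₁ i) + Polynomial.X * Polynomial.C (v₀ i))) =
        v₁ + z • v₀ := by
      funext i
      simp only [map_add, map_mul, Polynomial.aeval_C, Polynomial.aeval_X, Algebra.algebraMap_self,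
        RingHom.id_apply, Pi.add_apply, Pi.smul_apply, smul_eq_mul, mul_comm z]
    rw [hF]
  have hΨ0 : Ψ ≠ 0 := by
    intro h0
    have := hΨeval 0
    rw [h0, Polynomial.eval_zero, zero_smul, add_zero] at this
    exact hq₁ this.symm
  have hevA : ∀ᶠ m : ℕ in atTop, eval (v₁ + (m : ℂ) • v₀) Q ≠ 0 := by
    have hfin : {m : ℕ | Ψ.IsRoot (m : ℂ)}.Finite :=
      (Polynomial.finite_setOf_isRoot hΨ0).preimage (Nat.cast_injective.injOn)
    obtain ⟨m₀, hm₀⟩ := hfin.bddAbove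
    filter_upwards [eventually_gt_atTop m₀] with m hm
    intro hzero
    have hroot : m ∈ {m : ℕ | Ψ.IsRoot (m : ℂ)} := by
      show Ψ.IsRoot (m : ℂ)
      rw [Polynomial.IsRoot, hΨeval, hzero]
    exact absurd (hm₀ hroot) (not_le.mpr hm)
  -- (b) the sign of `Re h` persists at `v₁ + m v₀` for large `m`
  have hevB : ∀ᶠ m : ℕ in atTop, (eval (v₁ + (m : ℂ) • v₀) h).re < 0 := by
    have hcont : ContinuousAt (fun w : Fin s → ℂ => (eval w h).re) v₀ :=
      Complex.continuous_re.continuousAt.comp (MvPolynomial.continuous_eval h).continuousAt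
    have hnhds : ∀ᶠ w in 𝓝 v₀, (eval w h).re < 0 := hcont.eventually (eventually_lt_nhds hq₀)
    have htend : Tendsto (fun m : ℕ => v₀ + (m : ℂ)⁻¹ • v₁) atTop (𝓝 v₀) := by
      have h1 : Tendsto (fun m : ℕ => ((m : ℝ)⁻¹ : ℝ)) atTop (𝓝 0) :=
        tendsto_inv_atTop_zero.comp tendsto_natCast_atTop_atTop
      have h2 : Tendsto (fun m : ℕ => ((m : ℂ)⁻¹ : ℂ)) atTop (𝓝 0) := by
        have := (Complex.continuous_ofReal.tendsto 0).comp h1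
        simp only [Function.comp_def, Complex.ofReal_inv, Complex.ofReal_natCast,
          Complex.ofReal_zero] at this
        exact this
      have h3 : Tendsto (fun m : ℕ => (m : ℂ)⁻¹ • v₁) atTop (𝓝 0) := by
        simpa using h2.smul_const v₁
      simpa using h3.const_add v₀
    have hev1 : ∀ᶠ m : ℕ in atTop, (eval (v₀ + (m : ℂ)⁻¹ • v₁) h).re < 0 := htend.eventually hnhds
    filter_upwards [hev1, eventually_ge_atTop 1] with m hm hm1
    have hm0 : (m : ℂ) ≠ 0 := by exact_mod_cast (Nat.one_le_iff_ne_zero.mp hm1)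
    have hscale : v₁ + (m : ℂ) • v₀ = (m : ℂ) • (v₀ + (m : ℂ)⁻¹ • v₁) := by
      rw [smul_add, smul_smul, mul_inv_cancel₀ hm0, one_smul, add_comm]
    rw [hscale, hh.eval_smul_eq, show ((m : ℂ) ^ D) = ((m : ℝ) ^ D : ℝ) by push_cast; rfl,
      Complex.re_ofReal_mul]
    exact mul_neg_of_pos_of_neg (by positivity) hm
  obtain ⟨m, hmA, hmB⟩ := (hevA.and hevB).exists
  exact ⟨fun j => q₁ j + (m : ℤ) * q₀ j, by rw [hline]; exact hmA, by rw [hline]; exact hmB⟩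

/-! ### Exponential points over a graph hypersurface with Brownawell–Masser puncture fibre -/

/-- **EC over a negative graph hypersurface with Brownawell–Masser puncture fibre, with exponential
points Zariski dense over the base.** Let `s ≥ 1`,
`n = s + 1`, `g ∈ ℂ[x₁..xₛ]` of total degree `D ≥ 1` with `Re g_D(2πi q₀) < 0` for some lattice
direction `q₀ ∈ ℤˢ`, `W ⊆ ℂˢ × ℂˢ` irreducible Zariski closed of dimension `s` whose torus part
projects dominantly to `ℂˢ` (the hypotheses of Brownawell–Masser 2017 Prop. 2 in dimension `s`),
and `Fⱼ ∈ ℂ[u, x₁..xₛ]` arbitrary. Then there is `x ∈ ℂˢ` with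
`(x, (e^{xⱼ} - e^{g(x)} Fⱼ(e^{g(x)}, x))ⱼ) ∈ W`, avoiding any given hypersurface `h = 0` (so the
solutions are Zariski dense in `ℂˢ`). Equivalently the `n`-dimensional variety
`V = {xₙ = g(x'), (x', (yⱼ - yₙ Fⱼ(yₙ, x'))ⱼ) ∈ W} ⊆ ℂⁿ × (ℂˣ)ⁿ` — additive projection the graph
hypersurface `xₙ = g` (`dim π₁ V = n - 1`), fibre over the puncture divisor `yₙ = 0` equal to the
Brownawell–Masser variety `W` — meets the graph of `exp` (corollary
`punctureBM_inter_expGraph_nonempty`). This contains `exists_expPoint_punctureDecoupling`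
(`W = {yⱼ = aⱼ xⱼ + bⱼ}`) and lies in the open range of Zilber's Exponential-Algebraic Closedness
(Mantova–Masser PLMS 2024 p. 5; Aslanyan–Gallinaro 2024 §3.4). Proof: a good direction `q`
(`exists_good_direction`), the leading-form estimate `Re g ≤ -(c/2) m` on the balls `B(2πi m q, ρ m)`
(`ExpDominant.eval_smul_near_top`), and the localized perturbed Brownawell–Masser theorem
`exists_localized_perturbed_of_dominant` with `Gⱼ = e^{g} Fⱼ(e^{g}, ·)`.
[cite: MantovaMasser2023, §1 p.5 (the open case dim π(V) = 2 in ℂ³×ℂˣ³)] -/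
theorem exists_expPoint_punctureBM_avoiding {s : ℕ} (g : MvPolynomial (Fin s) ℂ)
    (hD : 0 < g.totalDegree) (q₀ : Fin s → ℤ)
    (hq₀ : (eval (fun j => 2 * Real.pi * I * (q₀ j : ℂ))
      (homogeneousComponent g.totalDegree g)).re < 0)
    (W : Set (Fin s ⊕ Fin s → ℂ)) (hW : IsIrreducibleClosed ℂ W) (hdim : zariskiDim ℂ W = s)
    (hdom : HasDominantAddProjection ℂ (W ∩ torusLocus ℂ s))
    (F : Fin s → MvPolynomial (Fin (s + 1)) ℂ) (h : MvPolynomial (Fin s) ℂ) (hh : h ≠ 0) :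
    ∃ x : Fin s → ℂ, eval x h ≠ 0 ∧ (Sum.elim x (fun j => exp (x j) -
        exp (eval x g) * eval (Fin.cons (exp (eval x g)) x) (F j)) : Fin s ⊕ Fin s → ℂ) ∈ W := by
  classical
  set D := g.totalDegree with hDdef
  obtain ⟨Q, hQ0, hdir⟩ := exists_localized_perturbed_of_dominant W hW hdim hdom
  set hT : MvPolynomial (Fin s) ℂ := homogeneousComponent h.totalDegree h with hhT
  have hQ'0 : Q * hT ≠ 0 := mul_ne_zero hQ0
    (Literature.NumberTheory.Transcendental.ExpDominant.homogeneousComponent_totalDegree_ne_zero hh)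
  obtain ⟨q, hqQ', hq⟩ := exists_good_direction (Q * hT) hQ'0 (homogeneousComponent D g)
    (homogeneousComponent_isHomogeneous D g) q₀ hq₀
  set v : Fin s → ℂ := fun j => 2 * Real.pi * I * (q j : ℂ) with hv
  rw [map_mul] at hqQ'
  have hqQ : eval v Q ≠ 0 := left_ne_zero_of_mul hqQ'
  have hqh : eval v hT ≠ 0 := right_ne_zero_of_mul hqQ'
  have hεh : 0 < ‖eval v hT‖ / 2 := by positivity
  obtain ⟨ρh, hρh, th, hth, hnearh⟩ :=
    Literature.NumberTheory.Transcendental.ExpDominant.eval_smul_near_top h v hεh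
  set c₀ : ℝ := -(eval v (homogeneousComponent D g)).re with hc₀
  have hc₀pos : 0 < c₀ := by rw [hc₀]; linarith
  obtain ⟨ρg, hρg, tg, htg, hnear⟩ :=
    Literature.NumberTheory.Transcendental.ExpDominant.eval_smul_near_top g v (half_pos hc₀pos)
  obtain ⟨ρ, hρ, hρle', K, hK, Nn, m₁, hm⟩ := hdir q hqQ (min ρg ρh) (lt_min hρg hρh)
  have hρle : ρ ≤ ρg := hρle'.trans (min_le_left _ _)
  have hρleh : ρ ≤ ρh := hρle'.trans (min_le_right _ _)
  have hgrowth := fun j =>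
    Literature.NumberTheory.Transcendental.HypersurfaceCover.exists_norm_eval_le_pow (F j)
  choose C hC N hCN using hgrowth
  set K' : ℝ := ‖v‖ + ρ with hK'
  have hK'0 : 0 ≤ K' := by positivity
  -- eventual smallness of the perturbation bound
  have hsmall : ∀ j, ∀ᶠ m : ℕ in atTop,
      C j * (2 + K') ^ N j * (64 * (s + 1) * (Real.exp 1 * K)) *
        ((m : ℝ) ^ (N j + Nn) / Real.exp (c₀ / 2 * m)) ≤ 1 := by
    intro j
    have h := (tendsto_pow_div_exp_natCast (N j + Nn) (half_pos hc₀pos)).const_mul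
      (C j * (2 + K') ^ N j * (64 * (s + 1) * (Real.exp 1 * K)))
    rw [mul_zero] at h
    exact h.eventually_le_const zero_lt_one
  have hall : ∀ᶠ m : ℕ in atTop, ((m₁ ≤ m ∧ th ≤ (m : ℝ)) ∧ tg ≤ (m : ℝ)) ∧ ∀ j,
      C j * (2 + K') ^ N j * (64 * (s + 1) * (Real.exp 1 * K)) *
        ((m : ℝ) ^ (N j + Nn) / Real.exp (c₀ / 2 * m)) ≤ 1 :=
    (((eventually_ge_atTop m₁).and (tendsto_natCast_atTop_atTop.eventually_ge_atTop th)).and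
      (tendsto_natCast_atTop_atTop.eventually_ge_atTop tg)).and (eventually_all.2 hsmall)
  obtain ⟨m, ⟨⟨hmm₁, hmth⟩, hmt⟩, hj⟩ := hall.exists
  obtain ⟨hm1, hmain⟩ := hm m hmm₁
  have hm1r : (1 : ℝ) ≤ m := by exact_mod_cast hm1
  have hm0 : (0 : ℝ) < m := by linarith
  have hmC : (m : ℂ) ≠ 0 := by exact_mod_cast hm0.ne'
  -- the perturbation
  set G : Fin s → (Fin s → ℂ) → ℂ := fun j z =>
    exp (eval z g) * eval (Fin.cons (exp (eval z g)) z) (F j) with hG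
  have hGdiff : ∀ j, Differentiable ℂ (G j) := by
    intro j
    have h1 : Differentiable ℂ fun z : Fin s → ℂ => exp (eval z g) :=
      (differentiable_mvPolynomial_eval g).cexp
    exact h1.mul ((differentiable_mvPolynomial_eval (F j)).comp (differentiable_finCons h1))
  have hGb : ∀ j, ∀ z ∈ ball ((m : ℂ) • v) (ρ * m),
      ‖G j z‖ ≤ (64 * (s + 1) * (Real.exp 1 * K * (m : ℝ) ^ Nn))⁻¹ := by
    intro j z hz
    rw [mem_ball, dist_eq_norm] at hz
    -- leading-form asymptotics
    set ζ : Fin s → ℂ := (m : ℂ)⁻¹ • (z - (m : ℂ) • v) with hζ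
    have hzζ : z = ((m : ℝ) : ℂ) • (v + ζ) := by
      rw [Complex.ofReal_natCast, hζ, smul_add, smul_smul, mul_inv_cancel₀ hmC, one_smul,
        add_sub_cancel]
    have hζρ : ‖ζ‖ ≤ ρg := by
      rw [hζ, norm_smul, norm_inv, Complex.norm_natCast, inv_mul_le_iff₀ hm0, mul_comm]
      exact hz.le.trans (mul_le_mul_of_nonneg_right hρle hm0.le)
    have hg' := hnear m hmt ζ hζρ
    rw [← hzζ, Complex.ofReal_natCast] at hg'
    have hre : (eval z g).re ≤ -(c₀ / 2 * m) := by
      have h1 : (eval z g - (m : ℂ) ^ D * eval v (homogeneousComponent D g)).re ≤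
          c₀ / 2 * (m : ℝ) ^ D := (Complex.re_le_norm _).trans hg'
      have h2 : ((m : ℂ) ^ D * eval v (homogeneousComponent D g)).re = -(c₀ * (m : ℝ) ^ D) := by
        have : (m : ℂ) ^ D = (((m : ℝ) ^ D : ℝ) : ℂ) := by push_cast; rfl
        rw [this, Complex.re_ofReal_mul, hc₀]; ring
      rw [Complex.sub_re, h2] at h1
      have h3 : (m : ℝ) ≤ (m : ℝ) ^ D := le_self_pow₀ hm1r hD.ne'
      nlinarith
    have hexp_le : ‖exp (eval z g)‖ ≤ (Real.exp (c₀ / 2 * m))⁻¹ := by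
      rw [Complex.norm_exp, ← Real.exp_neg]
      exact Real.exp_le_exp.mpr hre
    have hexp_le1 : ‖exp (eval z g)‖ ≤ 1 :=
      hexp_le.trans (inv_le_one_of_one_le₀ (Real.one_le_exp (by positivity)))
    have hzn : ‖z‖ ≤ K' * m := by
      calc ‖z‖ = ‖(m : ℂ) • v + (z - (m : ℂ) • v)‖ := by rw [add_sub_cancel]
        _ ≤ ‖(m : ℂ) • v‖ + ‖z - (m : ℂ) • v‖ := norm_add_le _ _
        _ ≤ m * ‖v‖ + ρ * m := by
            rw [norm_smul, Complex.norm_natCast]; exact add_le_add le_rfl hz.le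
        _ = K' * m := by rw [hK']; ring
    have hcons : ‖(Fin.cons (exp (eval z g)) z : Fin (s + 1) → ℂ)‖ ≤ 1 + K' * m :=
      norm_finCons_le hexp_le1 (by positivity) hzn
    have hFb : ‖eval (Fin.cons (exp (eval z g)) z) (F j)‖ ≤ C j * ((2 + K') * m) ^ N j := by
      refine (hCN j _).trans (mul_le_mul_of_nonneg_left ?_ (hC j))
      refine pow_le_pow_left₀ (by positivity) ?_ _
      nlinarith
    have hpos : (0 : ℝ) < 64 * (s + 1) * (Real.exp 1 * K * (m : ℝ) ^ Nn) := by positivity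
    have hGz : ‖G j z‖ ≤ (Real.exp (c₀ / 2 * m))⁻¹ * (C j * ((2 + K') * m) ^ N j) := by
      show ‖exp (eval z g) * eval (Fin.cons (exp (eval z g)) z) (F j)‖ ≤ _
      rw [norm_mul]
      exact mul_le_mul hexp_le hFb (norm_nonneg _) (by positivity)
    rw [← one_div, le_div_iff₀ hpos]
    calc ‖G j z‖ * (64 * (s + 1) * (Real.exp 1 * K * (m : ℝ) ^ Nn))
        ≤ (Real.exp (c₀ / 2 * m))⁻¹ * (C j * ((2 + K') * m) ^ N j) *
            (64 * (s + 1) * (Real.exp 1 * K * (m : ℝ) ^ Nn)) :=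
          mul_le_mul_of_nonneg_right hGz hpos.le
      _ = C j * (2 + K') ^ N j * (64 * (s + 1) * (Real.exp 1 * K)) *
            ((m : ℝ) ^ (N j + Nn) / Real.exp (c₀ / 2 * m)) := by
          rw [mul_pow, pow_add, div_eq_mul_inv]; ring
      _ ≤ 1 := hj j
  obtain ⟨x, hxball, hx⟩ := hmain G (fun j => (hGdiff j).differentiableOn) hGb
  refine ⟨x, ?_, hx⟩
  -- the solution avoids the hypersurface `h = 0`
  rw [mem_ball, dist_eq_norm] at hxball
  set ζ : Fin s → ℂ := (m : ℂ)⁻¹ • (x - (m : ℂ) • v) with hζ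
  have hxζ : x = ((m : ℝ) : ℂ) • (v + ζ) := by
    rw [Complex.ofReal_natCast, hζ, smul_add, smul_smul, mul_inv_cancel₀ hmC, one_smul,
      add_sub_cancel]
  have hζρ : ‖ζ‖ ≤ ρh := by
    rw [hζ, norm_smul, norm_inv, Complex.norm_natCast, inv_mul_le_iff₀ hm0, mul_comm]
    exact hxball.le.trans (mul_le_mul_of_nonneg_right hρleh hm0.le)
  have hnh := hnearh m hmth ζ hζρ
  rw [← hxζ, Complex.ofReal_natCast] at hnh
  intro hzero
  rw [hzero, zero_sub, norm_neg, norm_mul, norm_pow, Complex.norm_natCast] at hnh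
  have hmd : (0 : ℝ) < (m : ℝ) ^ h.totalDegree := by positivity
  have : ‖eval v hT‖ ≤ ‖eval v hT‖ / 2 := le_of_mul_le_mul_left (by linarith [hnh]) hmd
  have hpos : 0 < ‖eval v hT‖ := norm_pos_iff.mpr hqh
  linarith

/-- **EC over a negative graph hypersurface with Brownawell–Masser puncture fibre** (plain form
of `exists_expPoint_punctureBM_avoiding`, `h = 1`). [cite: MantovaMasser2023, §1 p.5 (the open case dim π(V) = 2 in ℂ³×ℂˣ³)] -/
theorem exists_expPoint_punctureBM {s : ℕ} (g : MvPolynomial (Fin s) ℂ) (hD : 0 < g.totalDegree)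
    (q₀ : Fin s → ℤ)
    (hq₀ : (eval (fun j => 2 * Real.pi * I * (q₀ j : ℂ))
      (homogeneousComponent g.totalDegree g)).re < 0)
    (W : Set (Fin s ⊕ Fin s → ℂ)) (hW : IsIrreducibleClosed ℂ W) (hdim : zariskiDim ℂ W = s)
    (hdom : HasDominantAddProjection ℂ (W ∩ torusLocus ℂ s))
    (F : Fin s → MvPolynomial (Fin (s + 1)) ℂ) :
    ∃ x : Fin s → ℂ, (Sum.elim x (fun j => exp (x j) -
        exp (eval x g) * eval (Fin.cons (exp (eval x g)) x) (F j)) : Fin s ⊕ Fin s → ℂ) ∈ W := by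
  obtain ⟨x, -, hx⟩ := exists_expPoint_punctureBM_avoiding g hD q₀ hq₀ W hW hdim hdom F 1 one_ne_zero
  exact ⟨x, hx⟩

/-- **The variety meets the graph of exponentiation** (EC-vocabulary form of
`exists_expPoint_punctureBM`): with `n = s + 1` and `x' = (x₁..xₛ)`, the subvariety
`V = {xₙ = g(x'), (x', (yⱼ - yₙ Fⱼ(yₙ, x'))ⱼ) ∈ W}` of `ℂⁿ × ℂⁿ` contains a point of
`Literature.NumberTheory.Transcendental.expGraph ℂ n` (hence of `ℂⁿ × (ℂˣ)ⁿ`).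
[cite: MantovaMasser2023, §1 p.5 (the open case dim π(V) = 2 in ℂ³×ℂˣ³)] -/
theorem punctureBM_inter_expGraph_nonempty {s : ℕ} (g : MvPolynomial (Fin s) ℂ)
    (hD : 0 < g.totalDegree) (q₀ : Fin s → ℤ)
    (hq₀ : (eval (fun j => 2 * Real.pi * I * (q₀ j : ℂ))
      (homogeneousComponent g.totalDegree g)).re < 0)
    (W : Set (Fin s ⊕ Fin s → ℂ)) (hW : IsIrreducibleClosed ℂ W) (hdim : zariskiDim ℂ W = s)
    (hdom : HasDominantAddProjection ℂ (W ∩ torusLocus ℂ s))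
    (F : Fin s → MvPolynomial (Fin (s + 1)) ℂ) :
    ({z : Fin (s + 1) ⊕ Fin (s + 1) → ℂ |
        z (Sum.inl (Fin.last s)) = eval (fun j => z (Sum.inl (Fin.castSucc j))) g ∧
        (Sum.elim (fun j => z (Sum.inl (Fin.castSucc j)))
            (fun j => z (Sum.inr (Fin.castSucc j)) - z (Sum.inr (Fin.last s)) *
              eval (Fin.cons (z (Sum.inr (Fin.last s))) fun i => z (Sum.inl (Fin.castSucc i)))
                (F j)) : Fin s ⊕ Fin s → ℂ) ∈ W} ∩
      Literature.NumberTheory.Transcendental.expGraph ℂ (s + 1)).Nonempty := by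
  obtain ⟨x, hx⟩ := exists_expPoint_punctureBM g hD q₀ hq₀ W hW hdim hdom F
  set X : Fin (s + 1) → ℂ := Fin.snoc x (eval x g) with hX
  refine ⟨Sum.elim X fun i => exp (X i), ⟨?_, ?_⟩, fun i => ?_⟩
  · simp [hX, Fin.snoc_last, Fin.snoc_castSucc]
  · simp only [Sum.elim_inl, Sum.elim_inr, hX, Fin.snoc_castSucc, Fin.snoc_last]
    exact hx
  · simp [Literature.ModelTheory.ExponentialFields.ExponentialRing.complex_exp_eq]

end Summit.Schanuel.Schanuel.Theorems
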